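import Literature.AnabelianGeometry.SemiGraphs.TemperedMaximalCompactSelfOfEscaping
import HarnessLib

/-!
# Verticial ⇒ maximal compact WITHOUT Kőnig: one level with no fixed edge suffices
# ([SemiAnbd] Thm 3.7 (iv), p. 41)

Mochizuki, *Semi-graphs of anabelioids*, Publ. RIMS **42** (2006), §3, Theorem 3.7 (iv), manuscript p. 41
[cite: MochizukiSemiAnbd2006, Thm 3.7(iv) p.41] ("the maximal compact subgroups of `π₁^temp(𝒢)` are precisely
the verticial subgroups"), with Lemma 1.8 (ii)(a),(b) p. 20 [cite: MochizukiSemiAnbd2006, Lem. 1.8(ii) p.20]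
(a compact group acting on a tree through a finite quotient fixes a vertex; the geodesic between two fixed
vertices is fixed pointwise).

PROOF-ONLY file (abc-iut cell, layer L3, row «T37iv-VERT⇒MAXCPT@RAYLESS-STAR», the GENERIC half; seat
abc-iut-L3-t6 gen 9; no definition, no named fact, nothing constructed).  Over abc-iut-L3-t10's
`VerticialLevelData D` of a chart `c` (the trees `𝒢_{∞,j}` with the action of `π₁^temp(𝒢)` and the
identifications (I1)–(I3)), abc-iut-w6-d063's `isMaximalCompactSubgroup_of_mem_verticialSubgroups_of_locallyFinite`
(`TemperedMaximalCompactSelfOfEscaping.lean`) proves «verticial ⇒ maximal compact» from LOCAL FINITENESS of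
the level trees: if a compact `K ⊋ V` does not fix the compatible vertex system `x` of `V`, then `V` fixes an
edge at `x_j` at EVERY level `j`, Kőnig makes these compatible, and (I3) puts `V` inside an edge-like
subgroup.  The present file removes Kőnig and (I3): the level-wise conclusion «`V` fixes an edge abutting
to `x_j`» (`exists_fixed_branch_at_of_not_fixed`) already contradicts a ONE-LEVEL hypothesis

  (NOFIX at `j`)  no edge of `𝒢_{∞,j}` abutting to `x_j` is fixed by all of `V`,

so a verticial subgroup satisfying (NOFIX) at a single level is a MAXIMAL compact subgroup
(`isMaximalCompactSubgroup_of_noFixedEdgeAt`, `_of_noFixedEdgeAt'` with the vertex system quantified away,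
`_of_noFixedEdge` with the stronger «`V` fixes no edge of `𝒢_{∞,j}` at all»).  No local finiteness, no
total elevation, no (I3) is used — only (I1) `fix`, (I2) `stab` and Thm 3.7 (ii) (`verticialDistinct_holds`,
through `le_of_forall_fixed_compatible`).  Consumer: the rayless star `𝒢⋆(p)` of abc-iut-L3-t8 (infinite
valence at the centre, where the level trees are NOT locally finite), companion file
`MetabelianLeafStarMaximalCompact.lean`.  Nothing here bears on [IUTchIII] Cor. 3.12 (IUT uses finite dual
semi-graphs only, settled by `maximalCompactIffVerticialAt_of_finiteGraph`); no side taken.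
-/

namespace Literature.AnabelianGeometry.SemiGraphs

namespace ProfiniteSemiGraph

namespace VerticialLevelData

open CategoryTheory

universe v u

variable {𝒢 : ProfiniteSemiGraph.{u}} {c : TemperedPiChart 𝒢} (D : VerticialLevelData.{v} 𝒢 c)

/-! ### A compact over-group that moves the vertex system forces fixed edges at every level -/

/-- **Level-wise fixed edges** (the Kőnig-free content of the proof of Thm 3.7 (iv), p. 41): let `V ≤ K`
with `K` compact, and let `x` be a compatible system of tree vertices fixed by `V`.  If some `k₀ ∈ K` moves
`x_{j₀}`, then at EVERY level `j` some branch abutting to `x_j` has its edge fixed by all of `V`: at a level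
`j'` above `j` and `j₀`, `K` fixes a vertex `y` (Lemma 1.8 (ii)(a)), `y ≠ x_{j'}` (else `k₀` would fix
`x_{j₀}` by transport), the geodesic `[x_{j'}, y]` is fixed pointwise by `V` (Lemma 1.8 (ii)(b)), and its first
half-edge is transported down to level `j`. [cite: MochizukiSemiAnbd2006, Thm 3.7(iv) p.41] -/
theorem exists_fixed_branch_at_of_not_fixed {V K : Subgroup c.G} (hVK : V ≤ K) (hK : IsCompact (K : Set c.G))
    (x : ∀ j, (D.tree j).Vertex) (hxc : ∀ ⦃i j : D.J⦄ (h : i ≤ j), (D.trans h).vertexMap (x j) = x i)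
    (hxV : ∀ g ∈ V, ∀ j, (D.act j g).hom.vertexMap (x j) = x j)
    {j₀ : D.J} {k₀ : c.G} (hk₀ : k₀ ∈ K) (hmove : (D.act j₀ k₀).hom.vertexMap (x j₀) ≠ x j₀) (j : D.J) :
    ∃ b : (D.tree j).Branch, (D.tree j).abuts b = some (x j) ∧
      ∀ g ∈ V, (D.act j g).hom.edgeMap ((D.tree j).edgeOf b) = (D.tree j).edgeOf b := by
  obtain ⟨j', hjj', hj₀j'⟩ := exists_ge_ge j j₀
  -- at the level `j'`: `K` fixes some `y ≠ x j'`
  obtain ⟨y, hy⟩ := D.exists_forall_mem_fixed_vertex_of_isCompact K hK j'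
  have hne : x j' ≠ y := by
    intro h
    have hfix' : (D.act j' k₀).hom.vertexMap (x j') = x j' := by rw [h]; exact hy k₀ hk₀
    apply hmove
    calc (D.act j₀ k₀).hom.vertexMap (x j₀)
        = (D.act j₀ k₀).hom.vertexMap ((D.trans hj₀j').vertexMap (x j')) := by rw [hxc hj₀j']
      _ = (D.trans hj₀j').vertexMap ((D.act j' k₀).hom.vertexMap (x j')) :=
          (D.trans_act_vertexMap hj₀j' k₀ (x j')).symm
      _ = x j₀ := by rw [hfix', hxc hj₀j']
  obtain ⟨b', hb', hfixb'⟩ := D.exists_forall_mem_fixed_edge_of_two_fixed_vertices V j' hne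
    (fun g hg => hxV g hg j') (fun g hg => hy g (hVK hg))
  -- transport the half-edge down to level `j`
  refine ⟨(D.trans hjj').branchMap b', ?_, fun g hg => ?_⟩
  · have h1 := (D.trans hjj').abuts_branchMap b' (x j') hb'
    rwa [hxc hjj'] at h1
  · rw [(D.trans hjj').edgeOf_branchMap, ← D.trans_act_edgeMap, hfixb' g hg]

/-! ### One level with no fixed edge at the vertex system ⇒ maximal compact -/

/-- **(NOFIX) at one level forces `K ≤ V`**: if `V` is verticial, `V ≤ K` compact, `x` is a compatible
`V`-fixed vertex system, and at SOME level `j` no branch abutting to `x_j` has its edge fixed by all of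
`V`, then `K ≤ V` — for either `K` fixes `x` (then (I2) + Thm 3.7 (ii), `le_of_forall_fixed_compatible`) or
`exists_fixed_branch_at_of_not_fixed` contradicts (NOFIX). [cite: MochizukiSemiAnbd2006, Thm 3.7(iv) p.41] -/
theorem le_of_noFixedEdgeAt (h37 : 𝒢.Thm37Hypotheses) {v : 𝒢.graph.Vertex} {V K : Subgroup c.G}
    (hV : V ∈ verticialSubgroups c v) (hVK : V ≤ K) (hK : IsCompact (K : Set c.G))
    (x : ∀ j, (D.tree j).Vertex) (hxc : ∀ ⦃i j : D.J⦄ (h : i ≤ j), (D.trans h).vertexMap (x j) = x i)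
    (hxV : ∀ g ∈ V, ∀ j, (D.act j g).hom.vertexMap (x j) = x j)
    (hnofix : ∃ j : D.J, ∀ b : (D.tree j).Branch, (D.tree j).abuts b = some (x j) →
      ∃ g ∈ V, (D.act j g).hom.edgeMap ((D.tree j).edgeOf b) ≠ (D.tree j).edgeOf b) :
    K ≤ V := by
  by_cases hKx : ∀ j, ∀ k ∈ K, (D.act j k).hom.vertexMap (x j) = x j
  · exact D.le_of_forall_fixed_compatible h37 hV hVK x hxc hKx
  · exfalso
    push Not at hKx
    obtain ⟨j₀, k₀, hk₀, hmove⟩ := hKx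
    obtain ⟨j, hj⟩ := hnofix
    obtain ⟨b, hb, hfix⟩ := D.exists_fixed_branch_at_of_not_fixed hVK hK x hxc hxV hk₀ hmove j
    obtain ⟨g, hg, hne⟩ := hj b hb
    exact hne (hfix g hg)

/-- **Verticial + (NOFIX) at one level of a given fixed vertex system ⇒ MAXIMAL compact** (Kőnig-free form
of «verticial ⇒ maximal compact», Thm 3.7 (iv)): no local finiteness of the level trees, no total
elevation, no (I3). [cite: MochizukiSemiAnbd2006, Thm 3.7(iv) p.41] -/
theorem isMaximalCompactSubgroup_of_noFixedEdgeAt (h37 : 𝒢.Thm37Hypotheses) {v : 𝒢.graph.Vertex}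
    {V : Subgroup c.G} (hV : V ∈ verticialSubgroups c v)
    (x : ∀ j, (D.tree j).Vertex) (hxc : ∀ ⦃i j : D.J⦄ (h : i ≤ j), (D.trans h).vertexMap (x j) = x i)
    (hxV : ∀ g ∈ V, ∀ j, (D.act j g).hom.vertexMap (x j) = x j)
    (hnofix : ∃ j : D.J, ∀ b : (D.tree j).Branch, (D.tree j).abuts b = some (x j) →
      ∃ g ∈ V, (D.act j g).hom.edgeMap ((D.tree j).edgeOf b) ≠ (D.tree j).edgeOf b) :
    IsMaximalCompactSubgroup V :=
  ⟨isCompact_of_mem_verticialSubgroups c hV, fun _ hK hVK =>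
    le_antisymm (D.le_of_noFixedEdgeAt h37 hV hVK hK x hxc hxV hnofix) hVK⟩

/-- **Verticial + (NOFIX) at one level ⇒ MAXIMAL compact**, with the vertex system quantified away: it is
enough that at SOME level `j` no branch abutting to a `V`-fixed vertex has its edge fixed by all of `V`
(apply the previous theorem to the system of (I1)). [cite: MochizukiSemiAnbd2006, Thm 3.7(iv) p.41] -/
theorem isMaximalCompactSubgroup_of_noFixedEdgeAt' (h37 : 𝒢.Thm37Hypotheses) {v : 𝒢.graph.Vertex}
    {V : Subgroup c.G} (hV : V ∈ verticialSubgroups c v)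
    (hnofix : ∃ j : D.J, ∀ y : (D.tree j).Vertex, (∀ g ∈ V, (D.act j g).hom.vertexMap y = y) →
      ∀ b : (D.tree j).Branch, (D.tree j).abuts b = some y →
        ∃ g ∈ V, (D.act j g).hom.edgeMap ((D.tree j).edgeOf b) ≠ (D.tree j).edgeOf b) :
    IsMaximalCompactSubgroup V := by
  obtain ⟨x, hxc, hxV⟩ := D.fix v V hV
  obtain ⟨j, hj⟩ := hnofix
  exact D.isMaximalCompactSubgroup_of_noFixedEdgeAt h37 hV x hxc hxV ⟨j, hj (x j) fun g hg => hxV g hg j⟩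

/-- **Verticial + «no edge of `𝒢_{∞,j}` is fixed by `V`» at one level `j` ⇒ MAXIMAL compact** (the
strongest and simplest form of (NOFIX): e.g. when the image of `V` in the level group is not contained in
any edge stabiliser for reasons of size or structure). [cite: MochizukiSemiAnbd2006, Thm 3.7(iv) p.41] -/
theorem isMaximalCompactSubgroup_of_noFixedEdge (h37 : 𝒢.Thm37Hypotheses) {v : 𝒢.graph.Vertex}
    {V : Subgroup c.G} (hV : V ∈ verticialSubgroups c v)
    (hnofix : ∃ j : D.J, ∀ e : (D.tree j).Edge, ∃ g ∈ V, (D.act j g).hom.edgeMap e ≠ e) :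
    IsMaximalCompactSubgroup V := by
  obtain ⟨j, hj⟩ := hnofix
  exact D.isMaximalCompactSubgroup_of_noFixedEdgeAt' h37 hV ⟨j, fun _ _ b _ => hj _⟩

/-- **The over-group form**: under (NOFIX) at one level, every compact subgroup containing the verticial
`V` equals `V` (the uniqueness-of-host shape consumed by the anchored / commensurator arguments).
[cite: MochizukiSemiAnbd2006, Thm 3.7(iv) p.41] -/
theorem eq_of_isCompact_of_le_of_noFixedEdgeAt' (h37 : 𝒢.Thm37Hypotheses) {v : 𝒢.graph.Vertex}
    {V K : Subgroup c.G} (hV : V ∈ verticialSubgroups c v) (hK : IsCompact (K : Set c.G)) (hVK : V ≤ K)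
    (hnofix : ∃ j : D.J, ∀ y : (D.tree j).Vertex, (∀ g ∈ V, (D.act j g).hom.vertexMap y = y) →
      ∀ b : (D.tree j).Branch, (D.tree j).abuts b = some y →
        ∃ g ∈ V, (D.act j g).hom.edgeMap ((D.tree j).edgeOf b) ≠ (D.tree j).edgeOf b) :
    K = V :=
  (D.isMaximalCompactSubgroup_of_noFixedEdgeAt' h37 hV hnofix).2 K hK hVK

end VerticialLevelData

end ProfiniteSemiGraph

end Literature.AnabelianGeometry.SemiGraphs
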